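import Mathlib
import HarnessLib
import Summits.QuantumFields.YangMills.Theorems.PencilRigidityCurvatureKernelBoundInfiniteVolumeCurvatureClustering

/-!
# `CurvatureKernelBound` — brick `InfiniteVolumeCurvatureClusteringR` (radius `betaOne`) of lead c11's
# "radius betaOne" wave (crux stmt-QuantumFields-11687, line `coupling-trichotomy`, skeleton v11)

This is the brick `InfiniteVolumeCurvatureClustering` of the tree
(`Summits/QuantumFields/YangMills/Theorems/PencilRigidityCurvatureKernelBoundInfiniteVolumeCurvatureClustering.lean`)
with the radius hypothesis `β' < betaOne 4 ρ / 4` relaxed to the full strong-coupling disc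
`β' < betaOne 4 ρ`.

For a bounded measurable LOCAL observable `Q` of the `ℤ⁴`-gauge configurations and couplings
`0 ≤ β ≤ β' < betaOne 4 ρ` the registered theorem packages: existence of the box limits `q β` of
`⟨Q ∘ τ_x⟩` and `P β (y − x)` of `⟨(Q ∘ τ_x)(Q ∘ τ_y)⟩`, their translation invariance, and the
β-uniform exponential clustering `|P β z − q β ^ 2| ≤ A e^{−m ‖z‖_∞}`.

## Proof

The only place where the original brick used the inner radius `betaOne/4` is the infinite-volume
limit `exists_differentiableOn_tendsto_expect` of the Literature, which applies the Schwarz lemma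
with the fixed radius `b/2` on the closed disc `b/4` (to get UNIFORM convergence and holomorphy of
the limit). For the box limits only POINTWISE convergence is needed, and the Cauchy argument works
at every complex coupling `‖β‖ < b := betaOne d ρ`: by the stabilisation of jets (`stab_expect`)
`⟨F⟩_Λ − ⟨F⟩_{Λ₀} = O(β^n)` for `Λ ⊇ Λ₀(n)`, it is holomorphic and bounded by `2M` on the disc of
radius `b` (`differentiableOn_expect`, `norm_expect_le`), so the Schwarz lemma with multiplicity
(`norm_le_of_isBigO_pow`) at the radius `r := (‖β‖ + b)/2 ∈ [‖β‖, b)` gives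
`‖⟨F⟩_Λ(β) − ⟨F⟩_{Λ₀}(β)‖ ≤ 2M θ^n` with `θ := ‖β‖/r < 1`; as `θ^n → 0` the net
`Λ ↦ ⟨F⟩_Λ(β)` is Cauchy over the directed type of finite regions, hence convergent
(`tendsto_expect_of_norm_lt_betaOne`). The rest is the original proof verbatim: real parts
(`zdExpect_eq`), cofinality of boxes and translated boxes (`tendsto_box_atTop`,
`expect_comp_translate`, `tendsto_box_image_add_atTop`) give `hasBoxLimit_zdExpect_of_dependsOn_R`;
the β-uniform finite-volume clustering `zdExpect_truncated_le_uniform` (already stated for general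
radii `β' < r < betaOne`) is used with `r := (β' + betaOne)/2` and the mass `m := log (r/β')`, and
passes to the box limit (`le_of_tendsto'`). Everything used is proved in the tree; no named facts.
Reference: K. Osterwalder, E. Seiler, Ann. Phys. 110 (1978) 440–471, Thms. 3.5–3.7
[OsterwalderSeilerAnnPhys1978]. [folklore]
-/

noncomputable section

open scoped BigOperators Topology
open MeasureTheory Filter
open Literature.MathematicalPhysics.QuantumFieldTheory Literature.Probability.LatticeModels

namespace Summit.QuantumFields.YangMills.Theorems.CurvatureKernel

/-! ### The pointwise infinite-volume limit on the full strong-coupling disc -/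

/-- **Infinite-volume limit at strong coupling, complex coupling, full disc.** For a bounded
measurable local observable `F` and every complex coupling `‖β‖ < betaOne d ρ` the finite-volume
expectations `⟨F⟩_Λ(β)` converge as `Λ ↑ ℤ^d` along the directed set of all finite regions
(stabilisation of jets + uniform bound + Schwarz lemma at the radius `(‖β‖ + betaOne)/2`; the
Literature's `exists_differentiableOn_tendsto_expect` is the same argument on the disc `betaOne/4`).
[folklore] -/
theorem tendsto_expect_of_norm_lt_betaOne {d N : ℕ} {G : Type*} [Group G] [TopologicalSpace G]
    [IsTopologicalGroup G] [CompactSpace G] [MeasurableSpace G] [BorelSpace G]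
    {ρ : G →* Matrix (Fin N) (Fin N) ℂ} (hρ : Continuous ρ) {B : Finset (ZdEdge d)}
    {F : ZdGaugeConfig d G → ℂ} (hFm : Measurable F) {C : ℝ} (hFb : ∀ U, ‖F U‖ ≤ C)
    (hFB : DependsOn F (B : Set (ZdEdge d))) {β : ℂ} (hβ : ‖β‖ < betaOne d ρ) :
    ∃ a : ℂ, Tendsto (fun Λ : Finset (Site d) => expect ρ F Λ β) atTop (𝓝 a) := by
  set b := betaOne d ρ with hb
  have hb0 : 0 < b := betaOne_pos d
  set M : ℝ := C * (2 * Real.exp (1 / 2)) ^ (Plaq.seedsOf B).card with hM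
  have hM0 : 0 ≤ M := (norm_nonneg _).trans
    (norm_expect_le hρ (β := 0) (by rw [norm_zero]; exact hb0.le) hFm hFb hFB ∅)
  -- the Schwarz radius `‖β‖ ≤ r < b` and the ratio `θ = ‖β‖ / r < 1`
  set r : ℝ := (‖β‖ + b) / 2 with hr
  have hr0 : 0 < r := by positivity
  have hrb : r < b := by rw [hr]; linarith
  have hβr : ‖β‖ ≤ r := by rw [hr]; linarith
  set θ : ℝ := ‖β‖ / r with hθ
  have hθ0 : 0 ≤ θ := by positivity
  have hθ1 : θ < 1 := by rw [hθ, div_lt_one hr0]; linarith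
  -- the Cauchy estimate from the stabilisation of jets and the Schwarz lemma
  have key : ∀ n : ℕ, ∃ Λ₀ : Finset (Site d), ∀ Λ, Λ₀ ⊆ Λ →
      ‖expect ρ F Λ β - expect ρ F Λ₀ β‖ ≤ 2 * M * θ ^ n := by
    intro n
    obtain ⟨Λ₀, hΛ₀⟩ := stab_expect hρ hFm hFb hFB n
    refine ⟨Λ₀, fun Λ hΛ => ?_⟩
    have hdiff : DifferentiableOn ℂ (fun β => expect ρ F Λ β - expect ρ F Λ₀ β) (Metric.ball 0 b) :=
      (differentiableOn_expect hρ hFm hFb Λ).sub (differentiableOn_expect hρ hFm hFb Λ₀)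
    have hbd : ∀ z ∈ Metric.ball (0 : ℂ) b, ‖expect ρ F Λ z - expect ρ F Λ₀ z‖ ≤ 2 * M := by
      intro z hz
      rw [Metric.mem_ball, dist_zero_right] at hz
      calc ‖expect ρ F Λ z - expect ρ F Λ₀ z‖ ≤ ‖expect ρ F Λ z‖ + ‖expect ρ F Λ₀ z‖ :=
            norm_sub_le _ _
        _ ≤ M + M := add_le_add (norm_expect_le hρ hz.le hFm hFb hFB Λ)
            (norm_expect_le hρ hz.le hFm hFb hFB Λ₀)
        _ = 2 * M := by ring
    exact norm_le_of_isBigO_pow hdiff hbd (hΛ₀ Λ hΛ) hr0 hrb hβr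
  choose Λ₀ hΛ₀ using key
  have hsmall : ∀ ε : ℝ, 0 < ε → ∃ n : ℕ, 4 * M * θ ^ n < ε := by
    intro ε hε
    have ht : Tendsto (fun n : ℕ => 4 * M * θ ^ n) atTop (𝓝 (4 * M * 0)) :=
      (tendsto_pow_atTop_nhds_zero_of_lt_one hθ0 hθ1).const_mul _
    rw [mul_zero] at ht
    exact (ht.eventually (gt_mem_nhds hε)).exists
  -- Cauchy over the directed type of finite regions, hence convergent
  have hcauchy : CauchySeq fun Λ : Finset (Site d) => expect ρ F Λ β := by
    refine Metric.cauchySeq_iff.2 fun ε hε => ?_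
    obtain ⟨n, hn⟩ := hsmall ε hε
    refine ⟨Λ₀ n, fun Λ hΛ Λ' hΛ' => ?_⟩
    rw [dist_eq_norm]
    calc ‖expect ρ F Λ β - expect ρ F Λ' β‖
        = ‖(expect ρ F Λ β - expect ρ F (Λ₀ n) β) - (expect ρ F Λ' β - expect ρ F (Λ₀ n) β)‖ := by
          rw [sub_sub_sub_cancel_right]
      _ ≤ ‖expect ρ F Λ β - expect ρ F (Λ₀ n) β‖ + ‖expect ρ F Λ' β - expect ρ F (Λ₀ n) β‖ :=
          norm_sub_le _ _
      _ ≤ 2 * M * θ ^ n + 2 * M * θ ^ n := add_le_add (hΛ₀ n Λ hΛ) (hΛ₀ n Λ' hΛ')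
      _ = 4 * M * θ ^ n := by ring
      _ < ε := hn
  exact cauchySeq_tendsto_of_complete hcauchy

/-! ### Infinite-volume limits at strong coupling, full radius -/

/-- **Infinite-volume limit and translation invariance at strong coupling, full radius**
(Osterwalder–Seiler 1978 Thms. 3.6–3.7; the original brick's `hasBoxLimit_zdExpect_of_dependsOn`
with `betaOne d ρ / 4` replaced by `betaOne d ρ`): for a bounded measurable observable `F`
supported on a finite bond set there is `g` with `⟨F⟩_{box L, β} → g β` and
`⟨F ∘ τ_a⟩_{box L, β} → g β` for every `|β| < betaOne d ρ` and every `a`. [folklore] -/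
theorem hasBoxLimit_zdExpect_of_dependsOn_R {d N : ℕ} {G : Type*} [Group G] [TopologicalSpace G]
    [IsTopologicalGroup G] [CompactSpace G] [MeasurableSpace G] [BorelSpace G]
    {ρ : G →* Matrix (Fin N) (Fin N) ℂ} (hρ : Continuous ρ) {F : ZdGaugeConfig d G → ℝ}
    {S : Finset (ZdEdge d)} (hS : DependsOn F (S : Set (ZdEdge d))) (hFm : Measurable F) {C : ℝ}
    (hC : ∀ U, |F U| ≤ C) :
    ∃ g : ℝ → ℝ, ∀ β : ℝ, |β| < betaOne d ρ →
      HasBoxLimit (fun Λ => zdExpect ρ β Λ F) (g β) ∧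
        ∀ a : Site d, HasBoxLimit (fun Λ => zdExpect ρ β Λ (F ∘ ZdGaugeConfig.translate a)) (g β) := by
  set Fc : ZdGaugeConfig d G → ℂ := fun U => (F U : ℂ) with hFc
  have hFcm : Measurable Fc := Complex.measurable_ofReal.comp hFm
  have hFcb : ∀ U, ‖Fc U‖ ≤ C := fun U => by
    simp only [hFc, Complex.norm_real, Real.norm_eq_abs]
    exact hC U
  have hFcS : DependsOn Fc (S : Set (ZdEdge d)) := fun U V h => by simp only [hFc, hS h]
  -- the pointwise limit on the full disc
  set g : ℂ → ℂ := fun β => limUnder atTop fun Λ : Finset (Site d) => expect ρ Fc Λ β with hg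
  refine ⟨fun t => (g t).re, fun β hβ => ?_⟩
  have hβ' : ‖(β : ℂ)‖ < betaOne d ρ := by rwa [Complex.norm_real, Real.norm_eq_abs]
  have hconv : Tendsto (fun Λ : Finset (Site d) => expect ρ Fc Λ β) atTop (𝓝 (g β)) :=
    tendsto_nhds_limUnder (tendsto_expect_of_norm_lt_betaOne hρ hFcm hFcb hFcS hβ')
  constructor
  · -- convergence along the boxes
    have hre : ∀ Λ, zdExpect ρ β Λ F = (expect ρ Fc Λ β).re := fun Λ => by
      rw [zdExpect_eq hρ β Λ hFm hC]
      rfl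
    have h1 : Tendsto (fun L : ℕ => expect ρ Fc (box d L) β) atTop (𝓝 (g β)) :=
      hconv.comp (Literature.MathematicalPhysics.QuantumFieldTheory.tendsto_box_atTop d)
    have h2 := (Complex.continuous_re.tendsto _).comp h1
    simp only [HasBoxLimit, hre]
    exact h2
  · -- translates: `⟨F ∘ τ_a⟩_Λ = ⟨F⟩_{Λ - a}` and translated boxes are cofinal
    intro a
    have hFam : Measurable (F ∘ ZdGaugeConfig.translate a) := hFm.comp (measurable_translate a)
    have hCa : ∀ U, |(F ∘ ZdGaugeConfig.translate a) U| ≤ C := fun U => hC _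
    have hre : ∀ Λ, zdExpect ρ β Λ (F ∘ ZdGaugeConfig.translate a) =
        (expect ρ Fc (Λ.image (· + -a)) β).re := fun Λ => by
      rw [zdExpect_eq hρ β Λ hFam hCa, ← expect_comp_translate hρ hFcm a Λ β]
      rfl
    have h1 : Tendsto (fun L : ℕ => expect ρ Fc ((box d L).image (· + -a)) β) atTop (𝓝 (g β)) :=
      hconv.comp
        (Literature.MathematicalPhysics.QuantumFieldTheory.tendsto_box_image_add_atTop d (-a))
    have h2 := (Complex.continuous_re.tendsto _).comp h1
    simp only [HasBoxLimit, hre]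
    exact h2

/-! ### The registered theorem -/

/-- **Brick R1 · `InfiniteVolumeCurvatureClusteringR`** (registered signature verbatim). For a
bounded measurable local observable `Q` of the `ℤ⁴`-gauge configurations and `0 < β' < betaOne 4 ρ`
(the FULL strong-coupling disc) there are ONE mass `m > 0`, ONE constant `A` and the
infinite-volume one- and two-point functions `q β = lim_L ⟨Q ∘ τ_x⟩_{box L, β}` (independent of
`x`) and `P β (y − x) = lim_L ⟨(Q ∘ τ_x)(Q ∘ τ_y)⟩_{box L, β}` such that for all `0 ≤ β ≤ β'` the
box limits exist, are translation invariant, and cluster exponentially, β-uniformly: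
`|P β z − q β ^ 2| ≤ A e^{−m ‖z‖_∞}` (Osterwalder–Seiler 1978 Thms. 3.5–3.7, free boundary
conditions; here `m = log ((β' + betaOne 4 ρ) / (2β'))`). [folklore] -/
theorem InfiniteVolumeCurvatureClusteringR : ∀ (N : ℕ) (G : Type) [Group G] [TopologicalSpace G] [IsTopologicalGroup G] [CompactSpace G] [T2Space G] [SecondCountableTopology G] [MeasurableSpace G] [BorelSpace G] (ρ : G →* Matrix (Fin N) (Fin N) ℂ), Continuous ρ → ∀ (Q : Literature.MathematicalPhysics.QuantumFieldTheory.ZdGaugeConfig 4 G → ℝ), Literature.MathematicalPhysics.QuantumFieldTheory.IsLocalObservable Q → Measurable Q → (∃ C : ℝ, ∀ U, |Q U| ≤ C) → ∀ β' : ℝ, 0 < β' → β' < betaOne 4 ρ → ∃ (m A : ℝ) (q : ℝ → ℝ) (P : ℝ → Literature.Probability.LatticeModels.Site 4 → ℝ), 0 < m ∧ ∀ β : ℝ, 0 ≤ β → β ≤ β' → (∀ x : Literature.Probability.LatticeModels.Site 4, Literature.Probability.LatticeModels.HasBoxLimit (fun Λ => Literature.MathematicalPhysics.QuantumFieldTheory.zdExpect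 ρ β Λ (Q ∘ Literature.MathematicalPhysics.QuantumFieldTheory.ZdGaugeConfig.translate x)) (q β)) ∧ (∀ x y : Literature.Probability.LatticeModels.Site 4, Literature.Probability.LatticeModels.HasBoxLimit (fun Λ => Literature.MathematicalPhysics.QuantumFieldTheory.zdExpect ρ β Λ (fun U => Q (Literature.MathematicalPhysics.QuantumFieldTheory.ZdGaugeConfig.translate x U) * Q (Literature.MathematicalPhysics.QuantumFieldTheory.ZdGaugeConfig.translate y U))) (P β (y - x))) ∧ ∀ z : Literature.Probability.LatticeModels.Site 4, |P β z - q β ^ 2| ≤ A * Real.exp (-(m * ‖z‖)) := by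
  intro N G _ _ _ _ _ _ _ _ ρ hρ Q hloc hQm hbdd β' hβ'0 hβ'
  obtain ⟨S, hS⟩ := hloc
  obtain ⟨C, hC⟩ := hbdd
  have hb0 : 0 < betaOne 4 ρ := betaOne_pos 4
  -- the strong-coupling radius `β' < r < betaOne` and the uniform finite-volume clustering
  set r : ℝ := (β' + betaOne 4 ρ) / 2 with hr
  have hβ'r : β' < r := by rw [hr]; linarith
  have hr1 : r < betaOne 4 ρ := by rw [hr]; linarith
  obtain ⟨A, hA⟩ := zdExpect_truncated_le_uniform hρ hS hQm hC hβ'0 hβ'r hr1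
  -- the mass
  set m : ℝ := Real.log (r / β') with hmdef
  have hm : 0 < m := Real.log_pos ((one_lt_div hβ'0).2 hβ'r)
  -- the one-point limits
  obtain ⟨gQ, hgQ⟩ := hasBoxLimit_zdExpect_of_dependsOn_R hρ hS hQm hC
  -- the two-point limits
  have hpair : ∀ z : Site 4, ∃ g : ℝ → ℝ, ∀ β : ℝ, |β| < betaOne 4 ρ →
      HasBoxLimit (fun Λ => zdExpect ρ β Λ (fun U => Q U * Q (ZdGaugeConfig.translate z U))) (g β) ∧
        ∀ a : Site 4, HasBoxLimit (fun Λ => zdExpect ρ β Λ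
          ((fun U => Q U * Q (ZdGaugeConfig.translate z U)) ∘ ZdGaugeConfig.translate a)) (g β) := by
    intro z
    refine hasBoxLimit_zdExpect_of_dependsOn_R hρ (S := S ∪ S.image fun e => (e.1 - -z, e.2)) ?_
      (hQm.mul (hQm.comp (measurable_translate z))) (C := C * C) ?_
    · intro U V h
      simp only [Finset.coe_union] at h
      show Q U * Q (ZdGaugeConfig.translate z U) = Q V * Q (ZdGaugeConfig.translate z V)
      have hU : Q U = Q V := hS (fun e he => h e (Or.inl he))
      have hU' : Q (ZdGaugeConfig.translate z U) = Q (ZdGaugeConfig.translate z V) := by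
        refine hS (fun e he => ?_)
        show U (e.1 + z, e.2) = V (e.1 + z, e.2)
        have hmem : ((e.1 - -z, e.2) : ZdEdge 4) ∈
            ((S.image fun e => (e.1 - -z, e.2) : Finset (ZdEdge 4)) : Set (ZdEdge 4)) :=
          Finset.mem_coe.2 (Finset.mem_image_of_mem _ he)
        have := h _ (Or.inr hmem)
        rwa [sub_neg_eq_add] at this
      rw [hU, hU']
    · intro U
      rw [abs_mul]
      exact mul_le_mul (hC _) (hC _) (abs_nonneg _) ((abs_nonneg _).trans (hC U))
  choose gP hgP using hpair
  refine ⟨m, A, gQ, fun β z => gP z β, hm, fun β hβ0 hββ' => ?_⟩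
  have hβlt : |β| < betaOne 4 ρ := by rw [abs_of_nonneg hβ0]; exact lt_of_le_of_lt hββ' hβ'
  have hβle : |β| ≤ β' := by rw [abs_of_nonneg hβ0]; exact hββ'
  refine ⟨fun x => (hgQ β hβlt).2 x, fun x y => ?_, fun z => ?_⟩
  · -- the pair observable is a translate of `Q · (Q ∘ τ_{y-x})`
    have hfun : (fun U : ZdGaugeConfig 4 G =>
        Q (ZdGaugeConfig.translate x U) * Q (ZdGaugeConfig.translate y U)) =
        (fun U => Q U * Q (ZdGaugeConfig.translate (y - x) U)) ∘ ZdGaugeConfig.translate x := by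
      funext U
      simp only [Function.comp_apply]
      congr 2
      funext e
      simp only [ZdGaugeConfig.translate]
      rw [add_assoc, sub_add_cancel]
    rw [hfun]
    exact (hgP (y - x) β hβlt).2 x
  · -- clustering passes to the limit
    have h1 : Tendsto (fun L : ℕ => zdExpect ρ β (box 4 L)
        (fun U => Q U * Q (ZdGaugeConfig.translate z U))) atTop (𝓝 (gP z β)) := (hgP z β hβlt).1
    have h2 : Tendsto (fun L : ℕ => zdExpect ρ β (box 4 L) Q) atTop (𝓝 (gQ β)) := (hgQ β hβlt).1
    have h3 : Tendsto (fun L : ℕ => zdExpect ρ β (box 4 L) (Q ∘ ZdGaugeConfig.translate z)) atTop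
        (𝓝 (gQ β)) := (hgQ β hβlt).2 z
    have h4 := (h1.sub (h2.mul h3)).abs
    have h5 : |gP z β - gQ β * gQ β| ≤ A * Real.exp (-(m * ‖z‖)) :=
      le_of_tendsto' h4 fun L => hA β hβle (box 4 L) z
    rwa [← pow_two] at h5

end Summit.QuantumFields.YangMills.Theorems.CurvatureKernel

end
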